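import Summits.QuantumFields.BalabanUV.Beta.WardBorderReflectionContact

/-!
# `BalabanUV.Beta.WardBorderReflectionContactAxis` — binder row D1, (L4): «D1-hRhW-SOCKET-CONSISTENCY» part 2b — THE CONSISTENCY IDENTITY
# ON THE MULTIPLIER LEGS OF THE REFLECTED AXIS (`inr α`): the generator's `q¹` letter and the GAUGE COVARIANCE of the linearised averaging

HONEST FRAMING (cell charter, verbatim): «discharging BetaPertH makes Balaban's UV stability UNCONDITIONAL — a real
constructive-QFT result; it is NOT the continuum limit and NOT the Clay problem.»  Neutral [folklore] algebra over a free first-order datum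
`(𝕄, S)`: on the legs `(z, inr α)` the product-chart generator carries the letter `−[off z = 0]·q¹,ρ_{(α, blk z)}(κ, u)` (an1's rooted linearised
averaging kernel `linKerAt`), so the block Ward divergence of the canonical contact picks up the PURE-GAUGE response of `q¹`
(an1's `AveragingContoursRooted.linAvgAt_grad`: the rooted averaging of an exact form is the coarse gradient at the ROOTS) = the COARSE face layer
`N_Y(Lc•Z + ρ + Lc•e_α) − N_Y(Lc•Z + ρ)`, which is exactly the reflection defect of `D_Y` on a reflected `inr α` leg
(`sref α (mref Lc α α z + ρ_c) = z + Lc•e_α + ρ_c` — the reflected `α`-multiplier leg acts at the root of the NEXT block).  No statement of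
Bałaban's papers, no `[cite:]`, no `def`; instantiates NO binder of the β-function wall (0/4: hW, hR, D1Tel, D1Rep); NOT hW, NOT hR, NOT D1, NOT
`BetaPertH`, NOT continuum, NOT Clay.
HONEST DEPENDENCY: continuum YM on T⁴ ⇐ BetaPertH ∧ nine spine estimates (0/9 proved); BetaPertH ⇐ (D1) ∧ (D4) ∧ CAP+tail;
G-an2-4 gates asym, D1 and NE2/3/4.

CONTENT (generic `d`, odd `Lc`, centred root `ρ_c = toSite (ctrOff (d+1) Lc) = ctr (d+1) Lc`):
* §1 `sref_mref_self_add_ctr`; §2 `linAvgAt_add'`∕`linAvgAt_finset_sum` (additivity of an1's rooted averaging in the form), **`sum_div_linKerAt`**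
  (`Σ_{v∈box} Σ_κ (q¹_{(α,Z)}(κ, Lc•Y+v−e_κ) − q¹_{(α,Z)}(κ, Lc•Y+v)) = N_Y(Lc•Z + ρ + Lc•e_α) − N_Y(Lc•Z + ρ)`);
* §3 `divV_canonD_inl_inr_axis` (per site), **`canonD_ward_eq_defect_inl_inr_axis`**: the identity at `(x, inl β; z, inr α)` under (H0) packing
  support of `S` and `𝕄` on multiplier legs, (H1), (H2), `s·γ₀ = −½`.
With parts 2a∕2a′ this leaves only the mirror axis block `(x, inr α; z, inl β)` (part 2b′) for the full border identity `W_Y(B_α) = G_α`.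
Provenance: β sub-cell, D1 formalisation swarm, unit b2b-balaban-beta-d1-formalise-leaf-04 gen 4, 2026-08-20 (v1); no existing file touched.
-/

open Finset
open scoped BigOperators
open Literature.MathematicalPhysics.QuantumFieldTheory
open Literature.MathematicalPhysics.QuantumFieldTheory.Balaban1983to89
open Literature.MathematicalPhysics.QuantumFieldTheory.Balaban1983to89.Beta
open ExpKernelCalculus (MKer)
open AffineAveraging (box toSite Form1)
open AveragingContours (blk off grad)
open AveragingContoursRooted (ctr ctrOff linAvgAt linAvgAt_grad linAvgAt_sub)
open AveragingHessianKernels (Bond single δ1 δ1_apply eq_smul_blk_of_off_eq_zero)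
open AveragingHessianKernelsRooted (linKerAt linCountAt)
open RootedKernelReflection (cast_linCountAt off_mref_eq_zero_iff)
open KernelWard (divV)
open PolarizationSign (reflSign axisReflect)
open KernelReflection (LegMap refK refK_apply)
open ResolventReflection (sref sref_apply sref_sref sref_add bref bref_self bref_of_ne mref Φ Φ_r_inl Φ_r_inr Φ_s_inl Φ_s_inr)
open OneStepResolventKernel (Fib)
open Summit.QuantumFields.BalabanUV.Beta.TameKernelCalculus
open Summit.QuantumFields.BalabanUV.Beta.ChartConjugation (conjV)
open Summit.QuantumFields.BalabanUV.Beta.BorderedHessian (diagK diagK_apply conjV_diagK_apply ctGen ctGen_inl ctGen_inr)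
open Summit.QuantumFields.BalabanUV.Beta.AveragingWardRootedStencils (legSite legInd legInd_inl legInd_inr)
open Summit.QuantumFields.BalabanUV.Beta.SecondOrderBorderGauge (actS actS_apply canonD canonD_apply)
open Summit.QuantumFields.BalabanUV.Beta.WardBorderReflection (unitVec_eq)
open Summit.QuantumFields.BalabanUV.Beta.WardBorderReflectionContact (sref_bref_of_ne sref_bref_self mref_add_ctr blockInd_sref dSym_inl dSym_inr
  sum_fieldLetter_div)

namespace Summit.QuantumFields.BalabanUV.Beta.WardBorderReflectionContactAxis

noncomputable section

variable {d : ℕ}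

/-! ## §1 The reflected `α`-multiplier leg acts at the root of the next block -/

/-- [folklore] For odd `Lc`: `sref α (mref Lc α α z + ρ_c) = z + Lc•e_α + ρ_c` (`2·((Lc−1)/2) = Lc − 1`). -/
theorem sref_mref_self_add_ctr (α : Fin (d + 1)) {Lc : ℕ} (hLc : Odd Lc) (z : Fin (d + 1) → ℤ) :
    sref α (mref Lc α α z + toSite (ctrOff (d + 1) Lc)) = z + (Lc : ℤ) • B6BondElimination.unitVec α + toSite (ctrOff (d + 1) Lc) := by
  obtain ⟨k, hk⟩ := hLc
  have hc : (((Lc - 1) / 2 : ℕ) : ℤ) = k := by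
    subst hk
    have : (2 * k + 1 - 1) / 2 = k := by omega
    rw [this]
  funext i
  unfold ResolventReflection.mref
  simp only [Pi.add_apply, Pi.smul_apply, smul_eq_mul, sref_apply, AffineAveraging.toSite, AveragingContoursRooted.ctrOff, hc,
    B6BondElimination.unitVec_apply]
  by_cases hi : i = α
  · subst hi
    simp only [if_true]
    subst hk; push_cast; ring
  · simp only [if_neg hi]; ring

/-! ## §2 The gauge covariance of the rooted linearised averaging: pure gauges go to coarse face layers -/

section Gauge

variable {R : Type*} [AddCommGroup R]

/-- [folklore] an1's rooted averaging is additive in the form. -/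
theorem linAvgAt_add' (ρ : Fin (d + 1) → ℤ) (A A' : Form1 (d + 1) R) (L : ℕ) (μ : Fin (d + 1)) (y : Fin (d + 1) → ℤ) :
    linAvgAt ρ (A + A') L μ y = linAvgAt ρ A L μ y + linAvgAt ρ A' L μ y := by
  have h := linAvgAt_sub ρ (A + A') A' L μ y
  rw [add_sub_cancel_right] at h
  rw [← sub_eq_iff_eq_add]
  exact h.symm

/-- [folklore] an1's rooted averaging over a finite sum of forms. -/
theorem linAvgAt_finset_sum {ι : Type*} (s : Finset ι) (ρ : Fin (d + 1) → ℤ) (A : ι → Form1 (d + 1) R) (L : ℕ) (μ : Fin (d + 1))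
    (y : Fin (d + 1) → ℤ) : linAvgAt ρ (∑ i ∈ s, A i) L μ y = ∑ i ∈ s, linAvgAt ρ (A i) L μ y := by
  classical
  induction s using Finset.induction_on with
  | empty =>
    have h := linAvgAt_sub ρ (0 : Form1 (d + 1) R) 0 L μ y
    rw [sub_self, sub_self] at h
    simpa using h
  | insert i s hi ih => rw [Finset.sum_insert hi, Finset.sum_insert hi, linAvgAt_add', ih]

end Gauge

/-- [folklore] **THE PURE-GAUGE RESPONSE OF `q¹`** (gauge covariance of the block averaging, linearised; an1's `linAvgAt_grad`): the block Ward
divergence, over the sites of the block `Y`, of the rooted linearised averaging kernel of the coarse bond `(α, Z)` in its bond slot is the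
coarse face layer `N_Y(Lc•Z + ρ + Lc•e_α) − N_Y(Lc•Z + ρ)` (`= [Z + e_α = Y] − [Z = Y]` for a root offset in the box). -/
theorem sum_div_linKerAt (ρ : Fin (d + 1) → ℤ) (Lc : ℕ) [NeZero Lc] (α : Fin (d + 1)) (Z Y : Fin (d + 1) → ℤ) :
    ∑ v ∈ box (d + 1) Lc, ∑ κ : Fin (d + 1),
        (linKerAt ρ Lc α Z (κ, (Lc : ℤ) • Y + toSite v - B6BondElimination.unitVec κ) - linKerAt ρ Lc α Z (κ, (Lc : ℤ) • Y + toSite v)) =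
      (∑ v ∈ box (d + 1) Lc, (if (Lc : ℤ) • Z + ρ + (Lc : ℤ) • B6BondElimination.unitVec α = (Lc : ℤ) • Y + toSite v then (1 : ℝ) else 0)) -
        ∑ v ∈ box (d + 1) Lc, (if (Lc : ℤ) • Z + ρ = (Lc : ℤ) • Y + toSite v then (1 : ℝ) else 0) := by
  have hL : (Lc : ℝ) ≠ 0 := by exact_mod_cast NeZero.ne Lc
  -- `#box = Lc^{d+1}` (as in `AffineAveraging`; the named copy lives in an unrelated GAN24 module)
  have card_box' : (box (d + 1) Lc).card = Lc ^ (d + 1) := by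
    simp [AffineAveraging.box, Fintype.card_piFinset, Finset.card_range, Finset.prod_const, Finset.card_univ, Fintype.card_fin]
  -- the block indicator as a function and the pure gauge as its gradient
  set f : (Fin (d + 1) → ℤ) → ℝ := fun w => ∑ v ∈ box (d + 1) Lc, (if w = (Lc : ℤ) • Y + toSite v then (1 : ℝ) else 0) with hf
  have hform : (∑ v ∈ box (d + 1) Lc, ∑ κ : Fin (d + 1),
      (single (κ, (Lc : ℤ) • Y + toSite v - B6BondElimination.unitVec κ) (1 : ℝ) - single (κ, (Lc : ℤ) • Y + toSite v) (1 : ℝ))) =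
      grad f := by
    funext κ' x
    simp only [Finset.sum_apply, Pi.sub_apply, AveragingHessianKernels.single, AveragingContours.grad, hf, Prod.mk.injEq,
      ← Finset.sum_sub_distrib]
    refine Finset.sum_congr rfl fun v _ => ?_
    rw [Finset.sum_eq_single κ']
    · have e1 : (κ' = κ' ∧ x = (Lc : ℤ) • Y + toSite v - B6BondElimination.unitVec κ') ↔
          x + AffineAveraging.unitVec κ' = (Lc : ℤ) • Y + toSite v := by
        rw [← unitVec_eq]
        constructor
        · rintro ⟨-, h⟩; rw [h, sub_add_cancel]
        · intro h; exact ⟨rfl, by rw [← h, add_sub_cancel_right]⟩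
      have e2 : (κ' = κ' ∧ x = (Lc : ℤ) • Y + toSite v) ↔ x = (Lc : ℤ) • Y + toSite v := by simp
      by_cases h1 : x + AffineAveraging.unitVec κ' = (Lc : ℤ) • Y + toSite v
      · rw [if_pos (e1.2 h1), if_pos h1]
        by_cases h2 : x = (Lc : ℤ) • Y + toSite v
        · rw [if_pos (e2.2 h2), if_pos h2]
        · rw [if_neg (fun h => h2 (e2.1 h)), if_neg h2]
      · rw [if_neg (fun h => h1 (e1.1 h)), if_neg h1]
        by_cases h2 : x = (Lc : ℤ) • Y + toSite v
        · rw [if_pos (e2.2 h2), if_pos h2]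
        · rw [if_neg (fun h => h2 (e2.1 h)), if_neg h2]
    · intro κ _ hκ
      rw [if_neg (fun h => hκ h.1.symm), if_neg (fun h => hκ h.1.symm), sub_zero]
    · intro h; exact absurd (Finset.mem_univ κ') h
  -- rewrite the kernel through an1's averaging and use its linearity
  have hq : ∀ f' : Bond (d + 1), linKerAt ρ Lc α Z f' = linAvgAt ρ (single f' (1 : ℝ)) Lc α Z / (Lc : ℝ) ^ (d + 1) := by
    intro f'
    rw [AveragingHessianKernelsRooted.linKerAt, cast_linCountAt]
  simp only [hq, ← sub_div]
  simp only [← Finset.sum_div]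
  have hlin : ∑ v ∈ box (d + 1) Lc, ∑ κ : Fin (d + 1),
      (linAvgAt ρ (single (κ, (Lc : ℤ) • Y + toSite v - B6BondElimination.unitVec κ) (1 : ℝ)) Lc α Z -
        linAvgAt ρ (single (κ, (Lc : ℤ) • Y + toSite v) (1 : ℝ)) Lc α Z) = linAvgAt ρ (grad f) Lc α Z := by
    rw [← hform, linAvgAt_finset_sum]
    refine Finset.sum_congr rfl fun v _ => ?_
    rw [linAvgAt_finset_sum]
    refine Finset.sum_congr rfl fun κ _ => ?_
    rw [linAvgAt_sub]
  rw [hlin, linAvgAt_grad, card_box', nsmul_eq_mul, Nat.cast_pow, mul_div_cancel_left₀ _ (pow_ne_zero _ hL), ← unitVec_eq]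

/-- [folklore] The pure-gauge response read at a packed multiplier site `z` (`off Lc z = 0`, so `z = Lc • blk Lc z`):
`Σ_v Σ_κ (q¹_{(α, blk z)}(κ, y_v − e_κ) − q¹_{(α, blk z)}(κ, y_v)) = N_Y(z + Lc•e_α + ρ) − N_Y(z + ρ)`. -/
theorem sum_div_linKerAt_blk (ρ : Fin (d + 1) → ℤ) (Lc : ℕ) [NeZero Lc] (α : Fin (d + 1)) {z : Fin (d + 1) → ℤ} (hz : off Lc z = 0)
    (Y : Fin (d + 1) → ℤ) :
    ∑ v ∈ box (d + 1) Lc, ∑ κ : Fin (d + 1),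
        (linKerAt ρ Lc α (blk Lc z) (κ, (Lc : ℤ) • Y + toSite v - B6BondElimination.unitVec κ) -
          linKerAt ρ Lc α (blk Lc z) (κ, (Lc : ℤ) • Y + toSite v)) =
      (∑ v ∈ box (d + 1) Lc, (if z + (Lc : ℤ) • B6BondElimination.unitVec α + ρ = (Lc : ℤ) • Y + toSite v then (1 : ℝ) else 0)) -
        ∑ v ∈ box (d + 1) Lc, (if z + ρ = (Lc : ℤ) • Y + toSite v then (1 : ℝ) else 0) := by
  have hL : 1 ≤ Lc := Nat.one_le_iff_ne_zero.mpr (NeZero.ne Lc)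
  rw [sum_div_linKerAt, ← eq_smul_blk_of_off_eq_zero hL hz, add_right_comm]

/-! ## §3 The consistency identity at the border entries `(x, inl β; z, inr α)` -/

section Identity

variable (Lc : ℕ) (α : Fin (d + 1)) (γ₀ s : ℝ) (𝕄 : MKer (d + 1) (Fib d))
  (S : Fin (d + 1) → (Fin (d + 1) → ℤ) → MKer (d + 1) (Fib d))

/-- [folklore] The generator's difference symbol at the entry `(x, inl β; z, inr α)`: the `inl` letter minus the packed `q¹` letter. -/
theorem ctGen_diff_axis (κ : Fin (d + 1)) (u x z : Fin (d + 1) → ℤ) (β : Fin (d + 1)) :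
    γ₀ * ctGen d α Lc κ u z (Sum.inr α) - γ₀ * ctGen d α Lc κ u x (Sum.inl β) =
      γ₀ * ((if x = u ∧ β = κ ∧ κ = α then (1 : ℝ) else 0) -
        (if off Lc z = 0 then (1 : ℝ) else 0) * linKerAt (ctr (d + 1) Lc) Lc α (blk Lc z) (κ, u)) := by
  rw [ctGen_inr, ctGen_inl]
  by_cases hz : off Lc z = 0
  · rw [if_pos ⟨rfl, hz⟩, if_pos hz]; split_ifs <;> ring
  · rw [if_neg (fun h => hz h.2), if_neg hz]; split_ifs <;> ring

/-- [folklore] **THE DIVERGENCE OF THE CANONICAL CONTACT AT ONE SITE**, entry `(x, inl β; z, inr α)`: face letter MINUS the `q¹` stencil divergence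
`Qd(y) = Σ_κ (q¹(κ, y−e_κ) − q¹(κ, y))`, times `γ₀·S κ′u′(e)` and `γ₀²·c′·𝕄(e)`, plus `γ₀·c′·(divV S y)(e)` with the REAL second-bond letter
`c′ = [x = u′ ∧ β = κ′ ∧ κ′ = α] − [off z = 0]·q¹(κ′, u′)`. -/
theorem divV_canonD_inl_inr_axis (κ' : Fin (d + 1)) (u' y x z : Fin (d + 1) → ℤ) (β : Fin (d + 1)) :
    divV (fun κ u => canonD 𝕄 S (fun κ u p c => γ₀ * ctGen d α Lc κ u p c) κ u κ' u') y x z (Sum.inl β) (Sum.inr α) =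
      γ₀ * S κ' u' x z (Sum.inl β) (Sum.inr α) *
          ((if β = α then ((if x + B6BondElimination.unitVec α = y then (1 : ℝ) else 0) - (if x = y then 1 else 0)) else 0) -
            (if off Lc z = 0 then (1 : ℝ) else 0) * ∑ κ : Fin (d + 1),
              (linKerAt (ctr (d + 1) Lc) Lc α (blk Lc z) (κ, y - B6BondElimination.unitVec κ) -
                linKerAt (ctr (d + 1) Lc) Lc α (blk Lc z) (κ, y))) +
        γ₀ * ((if x = u' ∧ β = κ' ∧ κ' = α then (1 : ℝ) else 0) -
            (if off Lc z = 0 then (1 : ℝ) else 0) * linKerAt (ctr (d + 1) Lc) Lc α (blk Lc z) (κ', u')) *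
          divV S y x z (Sum.inl β) (Sum.inr α) +
        γ₀ ^ 2 * ((if x = u' ∧ β = κ' ∧ κ' = α then (1 : ℝ) else 0) -
            (if off Lc z = 0 then (1 : ℝ) else 0) * linKerAt (ctr (d + 1) Lc) Lc α (blk Lc z) (κ', u')) * 𝕄 x z (Sum.inl β) (Sum.inr α) *
          ((if β = α then ((if x + B6BondElimination.unitVec α = y then (1 : ℝ) else 0) - (if x = y then 1 else 0)) else 0) -
            (if off Lc z = 0 then (1 : ℝ) else 0) * ∑ κ : Fin (d + 1),
              (linKerAt (ctr (d + 1) Lc) Lc α (blk Lc z) (κ, y - B6BondElimination.unitVec κ) -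
                linKerAt (ctr (d + 1) Lc) Lc α (blk Lc z) (κ, y))) := by
  have e : ∀ κ : Fin (d + 1), ∀ u : Fin (d + 1) → ℤ,
      canonD 𝕄 S (fun κ u p c => γ₀ * ctGen d α Lc κ u p c) κ u κ' u' x z (Sum.inl β) (Sum.inr α) =
        γ₀ * S κ' u' x z (Sum.inl β) (Sum.inr α) * ((if x = u ∧ β = κ ∧ κ = α then (1 : ℝ) else 0) -
            (if off Lc z = 0 then (1 : ℝ) else 0) * linKerAt (ctr (d + 1) Lc) Lc α (blk Lc z) (κ, u)) +
          γ₀ * ((if x = u' ∧ β = κ' ∧ κ' = α then (1 : ℝ) else 0) -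
              (if off Lc z = 0 then (1 : ℝ) else 0) * linKerAt (ctr (d + 1) Lc) Lc α (blk Lc z) (κ', u')) *
            S κ u x z (Sum.inl β) (Sum.inr α) +
          γ₀ ^ 2 * ((if x = u' ∧ β = κ' ∧ κ' = α then (1 : ℝ) else 0) -
              (if off Lc z = 0 then (1 : ℝ) else 0) * linKerAt (ctr (d + 1) Lc) Lc α (blk Lc z) (κ', u')) * 𝕄 x z (Sum.inl β) (Sum.inr α) *
            ((if x = u ∧ β = κ ∧ κ = α then (1 : ℝ) else 0) -
              (if off Lc z = 0 then (1 : ℝ) else 0) * linKerAt (ctr (d + 1) Lc) Lc α (blk Lc z) (κ, u)) := by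
    intro κ u
    rw [canonD_apply, ctGen_diff_axis, ctGen_diff_axis]
    ring
  simp only [KernelWard.divV, Finset.sum_apply, Pi.sub_apply, e]
  rw [← sum_fieldLetter_div α x y β]
  simp only [mul_sub, sub_mul, Finset.mul_sum]
  simp only [← Finset.sum_sub_distrib, ← Finset.sum_add_distrib]
  refine Finset.sum_congr rfl fun κ _ => ?_
  ring

/-- [folklore] **THE CONSISTENCY IDENTITY `W_Y(B_α) = G_α` AT THE ENTRIES `(x, inl β; z, inr α)`** for the canonical contact of ANY first-order
datum `(𝕄, S)` obeying (H0) packing support on multiplier legs (`S κ u (x; z, inr α) = 0 = 𝕄 (x; z, inr α)` unless `off Lc z = 0`), (H1) the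
reflection law, (H2) the block Ward law at these entries, with `s·γ₀ = −½`, odd `Lc`, centred root — the `q¹` letter's pure-gauge response
(`sum_div_linKerAt`) supplies exactly the coarse face layer by which `D` fails to be reflection invariant on the `inr α` legs. -/
theorem canonD_ward_eq_defect_inl_inr_axis [NeZero Lc] (hLc : Odd Lc) (hs : s * γ₀ = -(1 / 2 : ℝ))
    (h0S : ∀ (κ : Fin (d + 1)) (u x z : Fin (d + 1) → ℤ) (β : Fin (d + 1)), off Lc z ≠ 0 → S κ u x z (Sum.inl β) (Sum.inr α) = 0)
    (h0M : ∀ (x z : Fin (d + 1) → ℤ) (β : Fin (d + 1)), off Lc z ≠ 0 → 𝕄 x z (Sum.inl β) (Sum.inr α) = 0)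
    (hlaw : actS Lc α S = fun κ u => S κ u + conjV 𝕄 (diagK fun p c => γ₀ * ctGen d α Lc κ u p c))
    (hward : ∀ (Y x z : Fin (d + 1) → ℤ) (β : Fin (d + 1)),
      (∑ v ∈ box (d + 1) Lc, divV S ((Lc : ℤ) • Y + toSite v)) x z (Sum.inl β) (Sum.inr α) =
        ((-2 * γ₀) • conjV 𝕄 (diagK ((1 / 2 : ℝ) • ∑ v ∈ box (d + 1) Lc,
          legInd (toSite (ctrOff (d + 1) Lc)) ((Lc : ℤ) • Y + toSite v)))) x z (Sum.inl β) (Sum.inr α))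
    (Y : Fin (d + 1) → ℤ) (κ' : Fin (d + 1)) (u' x z : Fin (d + 1) → ℤ) (β : Fin (d + 1)) :
    (s • ∑ v ∈ box (d + 1) Lc, divV (fun κ u => canonD 𝕄 S (fun κ u p c => γ₀ * ctGen d α Lc κ u p c) κ u κ' u')
        ((Lc : ℤ) • Y + toSite v)) x z (Sum.inl β) (Sum.inr α) =
      (reflSign α κ' • refK (Φ (d := d) Lc α) (conjV (S κ' (bref α κ' u'))
          (diagK ((1 / 2 : ℝ) • ∑ v ∈ box (d + 1) Lc, legInd (toSite (ctrOff (d + 1) Lc)) ((Lc : ℤ) • sref α Y + toSite v)))) -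
        conjV (S κ' u') (diagK ((1 / 2 : ℝ) • ∑ v ∈ box (d + 1) Lc, legInd (toSite (ctrOff (d + 1) Lc)) ((Lc : ℤ) • Y + toSite v))))
        x z (Sum.inl β) (Sum.inr α) := by
  have hL1 : 1 ≤ Lc := Nat.one_le_iff_ne_zero.mpr (NeZero.ne Lc)
  set ρ : Fin (d + 1) → ℤ := toSite (ctrOff (d + 1) Lc) with hρ
  set A : ℝ := S κ' u' x z (Sum.inl β) (Sum.inr α) with hA
  set M : ℝ := 𝕄 x z (Sum.inl β) (Sum.inr α) with hM
  set Nx : ℝ := ∑ v ∈ box (d + 1) Lc, (if x = (Lc : ℤ) • Y + toSite v then (1 : ℝ) else 0) with hNx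
  set Nxe : ℝ := ∑ v ∈ box (d + 1) Lc, (if x + B6BondElimination.unitVec α = (Lc : ℤ) • Y + toSite v then (1 : ℝ) else 0) with hNxe
  set Nz : ℝ := ∑ v ∈ box (d + 1) Lc, (if z + ρ = (Lc : ℤ) • Y + toSite v then (1 : ℝ) else 0) with hNz
  set Nzf : ℝ := ∑ v ∈ box (d + 1) Lc, (if z + (Lc : ℤ) • B6BondElimination.unitVec α + ρ = (Lc : ℤ) • Y + toSite v then (1 : ℝ) else 0)
    with hNzf
  set c' : ℝ := (if x = u' ∧ β = κ' ∧ κ' = α then (1 : ℝ) else 0) -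
    (if off Lc z = 0 then (1 : ℝ) else 0) * linKerAt (ctr (d + 1) Lc) Lc α (blk Lc z) (κ', u') with hc'
  -- (H1) at this entry
  have hlaw_e : reflSign α κ' * (reflSign α β * reflSign α α *
      S κ' (bref α κ' u') (bref α β x) (mref Lc α α z) (Sum.inl β) (Sum.inr α)) = A + M * (γ₀ * c') := by
    have e := congrFun (congrFun (congrFun (congrFun (congrFun (congrFun hlaw κ') u') x) z) (Sum.inl β)) (Sum.inr α)
    rw [actS_apply, Φ_s_inl, Φ_s_inr, Φ_r_inl, Φ_r_inr] at e
    rw [e, Pi.add_apply, Pi.add_apply, Pi.add_apply, Pi.add_apply, conjV_diagK_apply, ctGen_diff_axis]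
  -- the reflected symbols of `D`
  have hDz : ((1 / 2 : ℝ) • ∑ v ∈ box (d + 1) Lc, legInd ρ ((Lc : ℤ) • sref α Y + toSite v)) (mref Lc α α z) (Sum.inr α) =
      (1 / 2 : ℝ) * Nzf := by
    rw [dSym_inr, blockInd_sref, sref_mref_self_add_ctr α hLc]
  have hDx : ((1 / 2 : ℝ) • ∑ v ∈ box (d + 1) Lc, legInd ρ ((Lc : ℤ) • sref α Y + toSite v)) (bref α β x) (Sum.inl β) =
      (1 / 2 : ℝ) * (if β = α then Nxe else Nx) := by
    rw [dSym_inl, blockInd_sref]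
    by_cases hβ : β = α
    · subst hβ; rw [if_pos rfl, sref_bref_self]
    · rw [if_neg hβ, sref_bref_of_ne α hβ]
  have hDz0 : ((1 / 2 : ℝ) • ∑ v ∈ box (d + 1) Lc, legInd ρ ((Lc : ℤ) • Y + toSite v)) z (Sum.inr α) = (1 / 2 : ℝ) * Nz :=
    dSym_inr Lc ρ Y z α
  have hDx0 : ((1 / 2 : ℝ) • ∑ v ∈ box (d + 1) Lc, legInd ρ ((Lc : ℤ) • Y + toSite v)) x (Sum.inl β) = (1 / 2 : ℝ) * Nx :=
    dSym_inl Lc ρ Y x β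
  -- (H2) at this entry
  have hward_e : (∑ v ∈ box (d + 1) Lc, divV S ((Lc : ℤ) • Y + toSite v)) x z (Sum.inl β) (Sum.inr α) =
      (-2 * γ₀) * (M * ((1 / 2 : ℝ) * Nz - (1 / 2 : ℝ) * Nx)) := by
    rw [hward, Pi.smul_apply, Pi.smul_apply, Pi.smul_apply, Pi.smul_apply, smul_eq_mul, conjV_diagK_apply, hDz0, hDx0]
  -- LHS
  have hL : (∑ v ∈ box (d + 1) Lc, divV (fun κ u => canonD 𝕄 S (fun κ u p c => γ₀ * ctGen d α Lc κ u p c) κ u κ' u')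
      ((Lc : ℤ) • Y + toSite v)) x z (Sum.inl β) (Sum.inr α) =
      γ₀ * A * ((if β = α then Nxe - Nx else 0) - (if off Lc z = 0 then (1 : ℝ) else 0) * (Nzf - Nz)) +
        γ₀ * c' * ((∑ v ∈ box (d + 1) Lc, divV S ((Lc : ℤ) • Y + toSite v)) x z (Sum.inl β) (Sum.inr α)) +
        γ₀ ^ 2 * c' * M * ((if β = α then Nxe - Nx else 0) - (if off Lc z = 0 then (1 : ℝ) else 0) * (Nzf - Nz)) := by
    have hFL : ∑ v ∈ box (d + 1) Lc,
        (if β = α then ((if x + B6BondElimination.unitVec α = (Lc : ℤ) • Y + toSite v then (1 : ℝ) else 0) -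
          (if x = (Lc : ℤ) • Y + toSite v then 1 else 0)) else 0) = if β = α then Nxe - Nx else 0 := by
      by_cases hβ : β = α
      · simp only [if_pos hβ, Finset.sum_sub_distrib, hNxe, hNx]
      · simp only [if_neg hβ, Finset.sum_const_zero]
    have hQ : ∑ v ∈ box (d + 1) Lc, (if off Lc z = 0 then (1 : ℝ) else 0) * ∑ κ : Fin (d + 1),
        (linKerAt (ctr (d + 1) Lc) Lc α (blk Lc z) (κ, (Lc : ℤ) • Y + toSite v - B6BondElimination.unitVec κ) -
          linKerAt (ctr (d + 1) Lc) Lc α (blk Lc z) (κ, (Lc : ℤ) • Y + toSite v)) =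
        (if off Lc z = 0 then (1 : ℝ) else 0) * (Nzf - Nz) := by
      rw [← Finset.mul_sum]
      by_cases hz : off Lc z = 0
      · rw [if_pos hz, one_mul, one_mul]
        exact sum_div_linKerAt_blk (ctr (d + 1) Lc) Lc α hz Y
      · rw [if_neg hz, zero_mul, zero_mul]
    have hBW : ∑ v ∈ box (d + 1) Lc, divV S ((Lc : ℤ) • Y + toSite v) x z (Sum.inl β) (Sum.inr α) =
        (∑ v ∈ box (d + 1) Lc, divV S ((Lc : ℤ) • Y + toSite v)) x z (Sum.inl β) (Sum.inr α) := by
      rw [Finset.sum_apply, Finset.sum_apply, Finset.sum_apply, Finset.sum_apply]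
    rw [Finset.sum_apply, Finset.sum_apply, Finset.sum_apply, Finset.sum_apply]
    simp only [divV_canonD_inl_inr_axis Lc α γ₀ 𝕄 S]
    rw [← hA, ← hM, ← hc', ← hBW, ← hFL, ← hQ]
    simp only [mul_sub, Finset.mul_sum]
    simp only [← Finset.sum_sub_distrib, ← Finset.sum_add_distrib]
  -- assemble
  have hγ : γ₀ ≠ 0 := by
    rintro rfl; norm_num at hs
  have hs' : s = -(1 / 2 : ℝ) / γ₀ := by
    field_simp; linarith [hs]
  rw [Pi.smul_apply, Pi.smul_apply, Pi.smul_apply, Pi.smul_apply, smul_eq_mul, hL, hward_e]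
  rw [Pi.sub_apply, Pi.sub_apply, Pi.sub_apply, Pi.sub_apply, Pi.smul_apply, Pi.smul_apply, Pi.smul_apply, Pi.smul_apply,
    smul_eq_mul, refK_apply, Φ_s_inl, Φ_s_inr, Φ_r_inl, Φ_r_inr, conjV_diagK_apply, conjV_diagK_apply, hDz, hDx, hDz0, hDx0,
    ← hA]
  rw [show reflSign α κ' * (reflSign α β * reflSign α α *
      (S κ' (bref α κ' u') (bref α β x) (mref Lc α α z) (Sum.inl β) (Sum.inr α) * ((1 / 2 : ℝ) * Nzf - (1 / 2 : ℝ) * (if β = α then Nxe else Nx)))) =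
      (reflSign α κ' * (reflSign α β * reflSign α α * S κ' (bref α κ' u') (bref α β x) (mref Lc α α z) (Sum.inl β) (Sum.inr α))) *
        ((1 / 2 : ℝ) * Nzf - (1 / 2 : ℝ) * (if β = α then Nxe else Nx)) by ring, hlaw_e, hs']
  by_cases hz : off Lc z = 0
  · simp only [if_pos hz]
    by_cases hβ : β = α
    · simp only [if_pos hβ]
      field_simp
      ring
    · simp only [if_neg hβ]
      field_simp
      ring
  · -- off the packed sublattice everything vanishes
    have hA0 : A = 0 := h0S κ' u' x z β hz
    have hM0 : M = 0 := h0M x z β hz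
    simp only [if_neg hz, hA0, hM0]
    ring

end Identity

end

end Summit.QuantumFields.BalabanUV.Beta.WardBorderReflectionContactAxis
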